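import Summits.AtomisticToContinuum.BoseEinsteinCondensation.Theses.BECModePrice
import Literature.MathematicalPhysics.QuantumManyBody.PeriodicBoseGasFracEnergy
import Literature.Barriers.AtomisticToContinuum.KineticGapLengthScalesNarrow
import HarnessLib

/-!
# Disproof work file — crux `ModePriceIntegrable` (stmt-AtomisticToContinuum-18512, route BECModePrice)

cdisprove seat `refuter-cdisprove-stmt-AtomisticToContinuum-18512-0`, cycle 1 (2026-08-17).
Everything below is `sorry`-free unless marked; axioms `propext`/`Classical.choice`/`Quot.sound`.

CRUX (verbatim the route decl, `modePriceIntegrable_iff_coeff_half` = `Iff.rfl`): for every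
repulsive finite-range integrable `v` there are `C, ρ₀ > 0` with, for `0 < ρ < ρ₀`, eventually in
`N`, for all `p ∈ ℤ³∖0` and all periodic trial states `Ψ` on the torus of side `L = (N/ρ)^{1/3}`:
`E₀^per(N,L) + ½|2πp/L|² n_p(Ψ) ≤ ⟨Ψ,HΨ⟩ + Cρ` (single-mode softening price, SMS), i.e.
`inf_Ψ ⟨Ψ,(H - ½k²a_k†a_k)Ψ⟩ ≥ E₀ - Cρ` uniformly in the mode and in `N`.

## Findings

* §0 READING. rc 0; the inlined plane wave / symbol are `planeWaveMode` / `fracDispersion 2`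
  (`Iff.rfl`); `2⁻¹ : ℝ≥0∞` is the genuine half; no `⊤`-junk (energies finite for integrable `v`,
  `n_p ∈ [0,N]` by Parseval, trial class inhabited for every `N` and `L > 0` by `constState`);
  `sideLength ρ N > 0`. The crux is parametrised here by the softening coefficient:
  `ModePriceWithCoeff c` (`c = 2⁻¹` is the crux).
* §1 LOAD-BEARING ANALYSIS — the coefficient (theorems `coefficient_threshold_free_gas`,
  `modePriceWithCoeff_false_of_one_lt`). Already for the FREE gas `v ≡ 0` (a legal instance:
  `IsRepulsiveFiniteRange 0`, `∫0 = 0 ≠ ⊤`): the body holds with EVERY coefficient `c ≤ 1` and zero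
  budget (one term of the Parseval identity `∑_p |k_p|² n_p = ∫|∇Ψ|²`), and FAILS for EVERY `c > 1`
  (witness: the Galilei boost `e^{2πi m·∑x_j/L}` of the constant state — occupation `n_m = N`
  (`cellOccupation_planeWaveMode_boost`, `condensateOccupation_constState`), energy `≤ N|k|²`
  (`exists_boost_energy_le` of the barrier file), and `|k| → ∞` along `m = j e₁`). Hence
  `¬ ModePriceWithCoeff c` for all `1 < c ≤ ⊤`: any proof must use `2⁻¹ ≤ 1`, i.e. the kinetic
  operator pays `k² n_k` and nothing pays more; the interacting content of the crux is entirely the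
  subtraction of `E₀` (at `v = 0`, `E₀ = 0` and the price is exactly `0` for all `c ≤ 1`).
  Mutation record (paper, not typed — see "Why it resists"): the factor `½` is NOT what protects a
  single mode at the Bogoliubov level when `v̂(k) ≥ 0` (full softening `c = 1` still has a bounded
  two-mode price, `sup_x [√(x²+2x) - ½√(x²+4x) - x/2]·ρv̂ ≈ 0.12μ`); it IS load-bearing for modes with
  `v̂_eff(k) < 0` (there `c = 1` makes the softened mode free and a macroscopic transfer gains the
  exchange `-ρ|v̂_eff(k)|` per particle — price extensive), and for the PAIR `(k,-k)`.
* §2 IDLE HYPOTHESIS / REDUCTIONS. `p ≠ 0` is decoration (`modePriceBody_zero_mode`: at `p = 0` the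
  symbol vanishes and the body is `E₀ ≤ ⟨Ψ,HΨ⟩ + Cρ`). Only LOW-ENERGY states matter: for every `v`
  and every `Ψ` with `⟨Ψ,HΨ⟩ ≥ 2E₀` the body holds with zero budget (`modePrice_of_twice_le`), so the
  crux is a statement about the window `E₀ ≤ ⟨Ψ,HΨ⟩ < 2E₀`.
* §3 LINE `Sketch` (notch-the-vertex, RESHAPED by the lead 14:40Z to the renormalised notch
  `t = 8π·a(v)`; stubs N, A, S, P landed p166277/p166390/p166071/p166130; open:
  F = `stub_gNotchedStructureFactor`, O = `stub_softenedGNotchedOccupation`; retired bare-notch stubs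
  `stub_notchedStructureFactor` (FALSE on paper, wave-1 evidence of the lead: Kac density-wave
  instability for `t = v̂(k)⁺ > e₀'' ≈ 8πa`) / `stub_softenedNotchedOccupation`). Junk audit of the new
  coupling: `t = 8π (scatteringLength v).toReal` is finite for the class (`scatteringLength_ne_top`
  from `∫v < ∞`); at `v ≡ 0`, `a = 0` (`scatteringLength_zero`), `t = 0` (`gNotchCoupling_zero_pot`),
  `F = E`, `M = 0`, and BOTH open stubs hold with `Φ = constState` (`constState_free_nearMin`,
  `stubO_zero_pot_witness`: the constant state minimises `E` and `E - s·n_m` for every `s ≤ |k|²`,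
  with `n_m(const) = 0`); the same holds for every `v` carried by a null set (e.g. `⊤·1_{|x|=R}`:
  `∫v = 0`, `a = 0`, all energy functionals equal the free ones) — not vacuous, not refutable at the
  junk models. Paper audit of the reshaped F: the density-wave test at wave vector `k` now nets
  `(A²N/4)[ρ(e₀''(ρ) - 8πa) + k²/2] > 0` (LHY stiffness `e₀'' - 8πa = 8πa(16/√π)√(ρa³)` plus quantum
  pressure), so the linear instability that killed the bare notch is gone for every `k`, with an
  LHY-thin margin only as `k → 0`; Bogoliubov size of the target `M_t = 8πaρ·S'(k)`,
  `S'(k) = k²/ε'_k ≤ 1`. Reshaped O: the residual `±k` coupling `ρ(ĝ(k) - 8πa) ≤ 0` is attractive but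
  the softened notched pair stays stable iff `k² > 2ρ(8πa - ĝ(k))` — true at low density for all
  `k ≥ 2π/L` (`8πa - ĝ(k) = O(k²R₀a)` in the infrared, `≤ 8πa` in the UV where `k² ≫ ρa`). No cheap
  kill; both leaves inherit the crux's wall (N-uniform correlation bounds at `O(ρ)`/`O(1)`-per-mode).
  Joint sufficiency (`ModePriceIntegrable_of`) is sorry-free in `Lines/Sketch.lean` (re-checked rc 0,
  2 sorries = F, O); nothing smuggled.

## Why it resists (attacks that cannot be made rigorous here — information for provers)

Every refutation of a statement `E₀ + gain(Ψ) ≤ ⟨Ψ,HΨ⟩ + budget` needs a LOWER bound on `E₀` to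
precision better than `gain - budget`. In the thermodynamic limit at fixed `ρ` the best lower
bounds (LSSY Thm 2.4, Fournais–Solovej LHY) have EXTENSIVE errors, so a witness must carry
`½k²n_k(Ψ) ≳ εN` in ONE mode while exceeding `E₀` by less than half of that kinetic energy: since
`T ≥ k²n_k`, the other degrees of freedom must sit `½k²n_k` BELOW `E₀` — impossible to certify
without solving the many-body problem to `O(1)`. Concretely (all at the paper level, `μ = 8πρa`):
boosts `e^{ik·∑x}Φ` (gain `½k²n₀(Φ) ≤ ½Nk²` vs cost `Nk²`: margin `½Nk²`, cf. §1 at `v = 0`);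
one/`M` Feynman phonons `ρ_k^M Ψ₀` (cost `Mk²/S(k)`, gain `½M k²/S(k)`-ish: factor 2);
phase imprints `e^{iε∑cos kx_j}` (cost `½ε²k²N`, gain `≤ ⅛ε²k²n₀`: factor 4); amplitude/density
waves (interaction-penalised, `v̂(k) > 0` near `k = 0`); fragmented `|N-M, M_k⟩` (cost
`(½k² + ρv̂(k))M > 0` at low density); over-squeezed pairs (two-mode su(1,1): `sup B = 0.049μ`,
pair `0.118μ`, full softening `≈ 0.12μ`); second-order PT in the UV (`ρ²v̂(k)²/(6k²)`, intensive).
High-density escape (soft spheres, `v̂(k₁) < 0`: the softened mean field is unstable iff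
`ρ > 3k₁²/(8|v̂(k₁)|)`, cluster-crystal regime) is excluded by `ρ < ρ₀(v)` — `ρ₀(v)` is load-bearing
on paper but no rigorous witness exists (again needs `E₀` from below at mean-field precision for a
sign-changing `v̂`). Zero budget (`C = 0`) is false for `v ≠ 0` on paper (price `> 0`) but a proof
needs `n_k > 0` for near-minimisers — a depletion LOWER bound, available only conditionally on BEC
plus sum rules (Pitaevskii–Stringari `n_k ≥ n₀mc/(2k) - ½` [Stringari1995, §2.2 (9)–(11)], which
also shows, conditionally, that `C(v) ≳ a(v)·(n₀/N)` — `C` uniform in `v` or a budget `o(ρ)` would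
be false). The planner's live risk (a `log L` in `C` from two-phonon weight at `-k`) is a one-loop
question about the SOFTENED NOTCHED mode (a Bose-polaron-like impurity of mass 2 coupled through
`ŵ(q)ρ_q`, `ŵ(±k) = 0`): its bare-mode occupation at one loop is
`ρ∫ŵ(q)²v_{k+q}²/(½k² + e_q + e_{k+q})² d³q`, IR-finite for `k` fixed and `~ √(ρa³) log(1/kξ)` as
`k → 0`, so `½k²n_k → 0` there — no log obstruction is visible at one loop for stub O.

Barriers: `KineticGapLengthScales(Narrow)` — its boost witnesses satisfy SMS with margin `½Nk²`
(this file's §1 is that computation at `v = 0`); `EnergyAsymptoticsWithoutCondensation` — not met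
(nothing asymptotic is subtracted); `PitaevskiiStringariOneDimension` — consistent (SMS is expected
true in 1D while the count fails). Negatives index (`ledger negatives`): nothing on single-mode
softening.
-/

noncomputable section

open MeasureTheory Filter
open scoped ENNReal NNReal ComplexConjugate

namespace Summit.AtomisticToContinuum.BoseEinsteinCondensation.Cruxes.ModePriceIntegrable.Disproof

open Literature.MathematicalPhysics.QuantumManyBody.BoseGas
open Literature.Barriers.AtomisticToContinuum.BoseGas
open Summit.AtomisticToContinuum.BoseEinsteinCondensation.Theses.BECModePrice

variable {N : ℕ} {L : ℝ}

/-! ## §0 The crux with the softening coefficient as a parameter -/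

/-- The body of the crux for one potential `v`, constants `C, ρ` and particle number `N`, with the
softening coefficient `c` in place of `2⁻¹`:
`∀ p ≠ 0, ∀ Ψ, E₀^per + c|2πp/L|² n_p(Ψ) ≤ ⟨Ψ,HΨ⟩ + Cρ`, `L = (N/ρ)^{1/3}`. [folklore] -/
def ModePriceBody (c : ℝ≥0∞) (v : ℝ → ℝ≥0∞) (C ρ : ℝ) (N : ℕ) : Prop :=
  ∀ p : Fin 3 → ℤ, p ≠ 0 → ∀ Ψ : PeriodicTrialState N (sideLength ρ N),
    periodicGroundStateEnergy v N (sideLength ρ N) +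
        c * fracDispersion 2 (sideLength ρ N) p *
          cellOccupation N (sideLength ρ N) (planeWaveMode (sideLength ρ N) p) Ψ.ψ ≤
      periodicEnergy v Ψ + ENNReal.ofReal (C * ρ)

/-- The crux with softening coefficient `c` (the crux is `c = 2⁻¹`). [folklore] -/
def ModePriceWithCoeff (c : ℝ≥0∞) : Prop :=
  ∀ v : ℝ → ℝ≥0∞, IsRepulsiveFiniteRange v → (∫⁻ x : Space, v ‖x‖) ≠ ⊤ →
    ∃ C : ℝ, 0 < C ∧ ∃ ρ₀ : ℝ, 0 < ρ₀ ∧ ∀ ρ : ℝ, 0 < ρ → ρ < ρ₀ →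
      ∀ᶠ N : ℕ in atTop, ModePriceBody c v C ρ N

/-- READING: the route decl is `ModePriceWithCoeff 2⁻¹`, definitionally. [folklore] -/
theorem modePriceIntegrable_iff_coeff_half : ModePriceIntegrable ↔ ModePriceWithCoeff 2⁻¹ :=
  Iff.rfl

/-! ## Tools: side length, the constant state, one Parseval term, boosts shift occupations -/

/-- `L = (N/ρ)^{1/3} > 0` for `ρ > 0`, `N ≥ 1`. [folklore] -/
theorem sideLength_pos {ρ : ℝ} (hρ : 0 < ρ) (hN : 0 < N) : 0 < sideLength ρ N :=
  Real.rpow_pos_of_pos (div_pos (Nat.cast_pos.2 hN) hρ) _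

/-- The amplitude `(L³)^{-N/2}` of the normalised constant state. [folklore] -/
def constAmp (N : ℕ) (L : ℝ) : ℝ := (Real.sqrt ((L ^ 3) ^ N))⁻¹

/-- `|(L³)^{-N/2}|² = (L³)^{-N}` in `ℝ≥0∞`. [folklore] -/
theorem nnnorm_constAmp_sq (hL : 0 < L) :
    ((‖(constAmp N L : ℂ)‖₊ : ℝ≥0∞) ^ 2) = ENNReal.ofReal ((L ^ 3) ^ N)⁻¹ := by
  have hApos : 0 < (L ^ 3) ^ N := by positivity
  rw [← ENNReal.coe_pow, ENNReal.ofReal, ENNReal.coe_inj]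
  ext
  rw [NNReal.coe_pow, coe_nnnorm, Complex.norm_real, constAmp, norm_inv,
    Real.norm_of_nonneg (Real.sqrt_nonneg _), inv_pow, Real.sq_sqrt hApos.le,
    Real.coe_toNNReal _ (by positivity)]

/-- **The constant state** `Ψ ≡ (L³)^{-N/2}` on the torus of side `L > 0`: admissible for every
`N` (non-vacuity of `∀ Ψ` in the crux), zero kinetic energy. [folklore] -/
def constState (N : ℕ) (hL : 0 < L) : PeriodicTrialState N L where
  ψ := fun _ => (constAmp N L : ℂ)
  contDiff := contDiff_const
  periodic := fun _ _ _ => rfl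
  symm := fun _ _ => rfl
  norm_eq := by
    have hApos : 0 < (L ^ 3) ^ N := by positivity
    have hvolA : (ENNReal.ofReal L ^ 3) ^ N = ENNReal.ofReal ((L ^ 3) ^ N) := by
      rw [← ENNReal.ofReal_pow hL.le, ← ENNReal.ofReal_pow (by positivity)]
    rw [setLIntegral_const, volume_cellN, nnnorm_constAmp_sq hL, hvolA,
      ← ENNReal.ofReal_mul (inv_nonneg.2 hApos.le), inv_mul_cancel₀ hApos.ne', ENNReal.ofReal_one]

/-- The constant state's value. [folklore] -/
@[simp] theorem constState_apply (hL : 0 < L) (X : Config N) :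
    (constState N hL).ψ X = (constAmp N L : ℂ) := rfl

/-- The constant state has no kinetic energy density. [folklore] -/
theorem kineticDensity_constState (hL : 0 < L) (X : Config N) :
    kineticDensity (constState N hL).ψ X = 0 := by
  simp [kineticDensity, constState]

/-- For the free gas the periodised interaction vanishes. [folklore] -/
theorem periodicInteraction_zero_pot (L : ℝ) (X : Config N) :
    periodicInteraction (0 : ℝ → ℝ≥0∞) L X = 0 := by
  simp [periodicInteraction, periodizedPotential]

/-- The free energy of the constant state is `0`. [folklore] -/
theorem periodicEnergy_constState_zero_pot (hL : 0 < L) :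
    periodicEnergy (0 : ℝ → ℝ≥0∞) (constState N hL) = 0 := by
  unfold periodicEnergy
  refine (lintegral_congr fun X => ?_).trans lintegral_zero
  rw [kineticDensity_constState, periodicInteraction_zero_pot, zero_mul, add_zero]

/-- `E₀^per(v ≡ 0, N, L) = 0` (`L > 0`, every `N`). [folklore] -/
theorem periodicGroundStateEnergy_zero_pot (hL : 0 < L) (N : ℕ) :
    periodicGroundStateEnergy (0 : ℝ → ℝ≥0∞) N L = 0 :=
  le_antisymm ((periodicGroundStateEnergy_le 0 (constState N hL)).trans
    (periodicEnergy_constState_zero_pot hL).le) bot_le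

/-- The constant state is a free-gas minimiser. [folklore] -/
theorem constState_free_nearMin (hL : 0 < L) (δ : ℝ≥0∞) :
    periodicEnergy (0 : ℝ → ℝ≥0∞) (constState N hL) ≤
      (⨅ Ψ : PeriodicTrialState N L, periodicEnergy (0 : ℝ → ℝ≥0∞) Ψ) + δ := by
  rw [periodicEnergy_constState_zero_pot]
  exact bot_le

/-- `|2πp/L|² ≠ 0` for `p ≠ 0`, `L ≠ 0`. [folklore] -/
theorem fracDispersion_two_ne_zero (hL : L ≠ 0) {p : Fin 3 → ℤ} (hp : p ≠ 0) :
    fracDispersion 2 L p ≠ 0 := by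
  obtain ⟨k, hk⟩ : ∃ k, p k ≠ 0 := Function.ne_iff.1 hp
  have hk' : (0 : ℝ) < ((p k : ℤ) : ℝ) ^ 2 := by
    have : ((p k : ℤ) : ℝ) ≠ 0 := by exact_mod_cast hk
    positivity
  have hsum : (0 : ℝ) < ∑ j : Fin 3, ((p j : ℤ) : ℝ) ^ 2 :=
    lt_of_lt_of_le hk' (Finset.single_le_sum (f := fun j => ((p j : ℤ) : ℝ) ^ 2)
      (fun j _ => sq_nonneg _) (Finset.mem_univ k))
  have hL2 : (0 : ℝ) < L ^ 2 := lt_of_le_of_ne (sq_nonneg L) (Ne.symm (pow_ne_zero 2 hL))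
  rw [fracDispersion_two, ne_eq, ENNReal.ofReal_eq_zero, not_le]
  exact div_pos (mul_pos (by positivity) hsum) hL2

/-- **One term of Parseval** (kinetic Markov bound, any `v`): `|2πp/L|² n_p(Ψ) ≤ ⟨Ψ,HΨ⟩`.
[folklore] -/
theorem fracDispersion_mul_cellOccupation_le (hL : 0 < L) (v : ℝ → ℝ≥0∞)
    (Ψ : PeriodicTrialState N L) (p : Fin 3 → ℤ) :
    fracDispersion 2 L p * cellOccupation N L (planeWaveMode L p) Ψ.ψ ≤ periodicEnergy v Ψ :=
  calc fracDispersion 2 L p * cellOccupation N L (planeWaveMode L p) Ψ.ψ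
      ≤ ∑' q : Fin 3 → ℤ, fracDispersion 2 L q * cellOccupation N L (planeWaveMode L q) Ψ.ψ :=
        ENNReal.le_tsum p
    _ = ∫⁻ X in cellN N L, kineticDensity Ψ.ψ X := tsum_fracDispersion_two_mul_cellOccupation hL Ψ
    _ ≤ periodicEnergy v Ψ := lintegral_mono fun _ => le_self_add

/-- The constant state has no particle in any mode `p ≠ 0` (Parseval for the gradient: every term
`|k_p|² n_p` of a vanishing sum vanishes). [folklore] -/
theorem cellOccupation_constState_eq_zero (hL : 0 < L) {p : Fin 3 → ℤ} (hp : p ≠ 0) :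
    cellOccupation N L (planeWaveMode L p) (constState N hL).ψ = 0 := by
  have h := tsum_fracDispersion_two_mul_cellOccupation hL (constState N hL)
  have h0 : ∫⁻ X in cellN N L, kineticDensity (constState N hL).ψ X = 0 :=
    (lintegral_congr fun X => kineticDensity_constState hL X).trans lintegral_zero
  rw [h0, ENNReal.tsum_eq_zero] at h
  exact (mul_eq_zero.1 (h p)).resolve_left (fracDispersion_two_ne_zero hL.ne' hp)

/-- The constant state is completely condensed: `⟨n₀⟩ = N` (Parseval `∑_p n_p = N` with all
`p ≠ 0` terms zero). [folklore] -/
theorem condensateOccupation_constState (hL : 0 < L) :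
    condensateOccupation N L (constState N hL).ψ = N := by
  rw [← cellOccupation_planeWaveMode_zero, ← (constState N hL).tsum_cellOccupation_planeWaveMode hL]
  exact (tsum_eq_single (0 : Fin 3 → ℤ) fun p hp => cellOccupation_constState_eq_zero hL hp).symm

/-- `∑ⱼ (x, Y)ⱼ = x + ∑ᵢ Yᵢ`. [folklore] -/
theorem configSum_vecCons {n : ℕ} (x : Space) (Y : Config n) :
    configSum (n + 1) (Matrix.vecCons x Y) = x + configSum n Y := by
  simp [Fin.sum_univ_succ]

/-- `‖e_m(x)‖₊ = 1`. [folklore] -/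
theorem nnnorm_cellWave (L : ℝ) (m : Fin 3 → ℤ) (x : Space) : ‖cellWave L m x‖₊ = 1 := by
  rw [← NNReal.coe_inj, coe_nnnorm, norm_cellWave, NNReal.coe_one]

/-- `conj(e_m) e_m = 1`. [folklore] -/
theorem conj_cellWave_mul_self (L : ℝ) (m : Fin 3 → ℤ) (x : Space) :
    conj (cellWave L m x) * cellWave L m x = 1 := by
  rw [conj_cellWave, ← cellWave_add_index, neg_add_cancel, cellWave_zero]

/-- The slice inner products of a boosted state with the boosted mode are, up to a phase, the
slice means of the original state: `⟨φ_m, Ψ_m(·,Y)⟩ = e_m(∑Y) ⟨φ_0, Φ(·,Y)⟩`. [folklore] -/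
theorem integral_conj_planeWaveMode_boost {n : ℕ} (hL : 0 < L) (m : Fin 3 → ℤ)
    (Φ : PeriodicTrialState (n + 1) L) (Y : Config n) :
    ∫ x in cell L, conj (planeWaveMode L m x) * (Φ.boost hL m).ψ (Matrix.vecCons x Y) =
      cellWave L m (configSum n Y) *
        ∫ x in cell L, conj (planeWaveMode L 0 x) * Φ.ψ (Matrix.vecCons x Y) := by
  rw [← integral_const_mul]
  congr 1
  funext x
  rw [boost_apply, planeWaveMode_eq L m x, planeWaveMode_zero L x, map_mul]
  unfold boostPhase
  rw [configSum_vecCons, cellWave_add]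
  have hc : conj (((Real.sqrt (L ^ 3))⁻¹ : ℂ)) = ((Real.sqrt (L ^ 3))⁻¹ : ℂ) := by
    rw [map_inv₀, Complex.conj_ofReal]
  rw [hc]
  linear_combination (((Real.sqrt (L ^ 3))⁻¹ : ℂ) * cellWave L m (configSum n Y) *
    Φ.ψ (Matrix.vecCons x Y)) * conj_cellWave_mul_self L m x

/-- **Boosts shift occupations**: the occupation of the mode `φ_m` in the Galilei boost
`Ψ_m = e^{2πi m·∑ⱼxⱼ/L}Φ` is the constant-mode occupation of `Φ`. [folklore] -/
theorem cellOccupation_planeWaveMode_boost (hL : 0 < L) (m : Fin 3 → ℤ)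
    (Φ : PeriodicTrialState N L) :
    cellOccupation N L (planeWaveMode L m) (Φ.boost hL m).ψ = condensateOccupation N L Φ.ψ := by
  cases N with
  | zero => simp [cellOccupation, condensateOccupation, occupation]
  | succ n =>
    rw [← cellOccupation_planeWaveMode_zero, cellOccupation_succ, cellOccupation_succ]
    congr 1
    refine lintegral_congr fun Y => ?_
    rw [integral_conj_planeWaveMode_boost hL m Φ Y, nnnorm_mul, nnnorm_cellWave, one_mul]

/-- `|2πm/L|² = ∑ₖ (2πm_k/L)²`: the crux's symbol is the barrier file's `boostGap`. [folklore] -/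
theorem fracDispersion_two_eq_boostGap (L : ℝ) (m : Fin 3 → ℤ) :
    fracDispersion 2 L m = ENNReal.ofReal (boostGap L m) := by
  rw [fracDispersion_two]
  congr 1
  unfold boostGap
  rw [Finset.mul_sum, Finset.sum_div]
  refine Finset.sum_congr rfl fun k _ => ?_
  ring

/-- `|−k|² = |k|²`. [folklore] -/
theorem boostGap_neg (L : ℝ) (m : Fin 3 → ℤ) : boostGap L (-m) = boostGap L m := by
  unfold boostGap
  refine Finset.sum_congr rfl fun k _ => ?_
  simp only [Pi.neg_apply, Int.cast_neg]
  ring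

/-- `v ≡ 0` is a legal instance of the class. [folklore] -/
theorem isRepulsiveFiniteRange_zero : IsRepulsiveFiniteRange (0 : ℝ → ℝ≥0∞) :=
  ⟨measurable_const, ⟨0, fun _ _ => rfl⟩⟩

/-! ## §1 Load-bearing analysis: the softening coefficient, at the free gas -/

/-- **Free gas, coefficient `≤ 1`: the body holds with zero price** (for every `C`, every `ρ > 0`,
every `N ≥ 1`, every mode): `E₀ = 0` and `c|k|²n_p ≤ |k|²n_p ≤ ∫|∇Ψ|² = ⟨Ψ,HΨ⟩`. So the free gas
is NOT a witness against the crux or against any coefficient up to `1`. [folklore] -/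
theorem modePriceBody_zero_pot_of_le_one {c : ℝ≥0∞} (hc : c ≤ 1) {ρ : ℝ} (hρ : 0 < ρ) (C : ℝ)
    (hN : 0 < N) : ModePriceBody c 0 C ρ N := by
  intro p _ Ψ
  have hL := sideLength_pos hρ hN
  rw [periodicGroundStateEnergy_zero_pot hL, zero_add]
  calc c * fracDispersion 2 _ p * cellOccupation N _ (planeWaveMode _ p) Ψ.ψ
      ≤ 1 * (fracDispersion 2 _ p * cellOccupation N _ (planeWaveMode _ p) Ψ.ψ) := by
        rw [mul_assoc]; exact mul_le_mul_of_nonneg_right hc bot_le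
    _ ≤ periodicEnergy 0 Ψ := by
        rw [one_mul]; exact fracDispersion_mul_cellOccupation_le hL 0 Ψ p
    _ ≤ periodicEnergy 0 Ψ + ENNReal.ofReal (C * ρ) := le_self_add

/-- **Free gas, coefficient `> 1`: the body FAILS** in every box (`ρ > 0`, `N ≥ 1`, any budget
`Cρ`). Witness: the boost `Ψ = e^{2πi m·∑ⱼxⱼ/L}·(L³)^{-N/2}` by `m = ±j e₁` with `j` large — it has
`n_m(Ψ) = N`, `⟨Ψ,HΨ⟩ ≤ N|k|²`, so the body would give `c N|k|² ≤ N|k|² + Cρ`, false once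
`(c-1)N|k|² > Cρ` (`c = ⊤` included). [folklore] -/
theorem not_modePriceBody_zero_pot_of_one_lt {c : ℝ≥0∞} (hc : 1 < c) {ρ : ℝ} (hρ : 0 < ρ) (C : ℝ)
    (hN : 0 < N) : ¬ ModePriceBody c 0 C ρ N := by
  intro h
  have hL := sideLength_pos hρ hN
  set L := sideLength ρ N with hLdef
  have hNr : (0 : ℝ) < N := Nat.cast_pos.2 hN
  -- constants: the budget `M` and the slope `K`
  set M : ℝ := max (C * ρ) 0 with hM
  have hM0 : 0 ≤ M := le_max_right _ _
  set K : ℝ := if c = ⊤ then 1 else (c.toReal - 1) * N with hK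
  have hK0 : 0 < K := by
    rw [hK]
    split_ifs with hct
    · exact one_pos
    · have h1 : (1 : ℝ≥0∞).toReal < c.toReal := (ENNReal.toReal_lt_toReal ENNReal.one_ne_top hct).2 hc
      rw [ENNReal.toReal_one] at h1
      exact mul_pos (by linarith) hNr
  -- a large axis momentum `j' e₁`
  obtain ⟨j, hj⟩ := exists_nat_gt (M * L ^ 2 / (4 * Real.pi ^ 2 * K))
  have hj1 : (1 : ℝ) ≤ (j + 1 : ℕ) := by exact_mod_cast Nat.succ_le_succ (Nat.zero_le j)
  have hj' : M * L ^ 2 / (4 * Real.pi ^ 2 * K) < (j + 1 : ℕ) :=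
    hj.trans (by exact_mod_cast Nat.lt_succ_self j)
  set p : Fin 3 → ℤ := axisMode ((j + 1 : ℕ) : ℤ) with hp
  have hp0 : p ≠ 0 := by
    intro h0
    have := congr_fun h0 0
    rw [hp, axisMode_apply_zero, Pi.zero_apply] at this
    exact Nat.succ_ne_zero j (by exact_mod_cast this)
  set d : ℝ := boostGap L p with hd
  have hd' : d = 4 * Real.pi ^ 2 * ((j + 1 : ℕ) : ℝ) ^ 2 / L ^ 2 := by
    rw [hd, hp, boostGap_axisMode]
    push_cast
    ring
  have hdpos : 0 < d := by rw [hd']; positivity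
  have hdK : M < d * K := by
    have hπ : (0 : ℝ) < 4 * Real.pi ^ 2 * K := by positivity
    have hL2 : (0 : ℝ) < L ^ 2 := by positivity
    have h1 : M * L ^ 2 < (j + 1 : ℕ) * (4 * Real.pi ^ 2 * K) := (div_lt_iff₀ hπ).1 hj'
    have h2 : ((j + 1 : ℕ) : ℝ) ≤ ((j + 1 : ℕ) : ℝ) ^ 2 := by nlinarith
    have h3 : M * L ^ 2 < ((j + 1 : ℕ) : ℝ) ^ 2 * (4 * Real.pi ^ 2 * K) :=
      h1.trans_le (mul_le_mul_of_nonneg_right h2 hπ.le)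
    rw [hd', div_mul_eq_mul_div, lt_div_iff₀ hL2]
    nlinarith [h3]
  -- the witness: a boost of the constant state
  set Φ := constState N hL with hΦ
  obtain ⟨m', hm', hE⟩ := exists_boost_energy_le hL 0 p Φ
  have hm'0 : m' ≠ 0 := by
    rcases hm' with rfl | rfl
    · exact hp0
    · exact neg_ne_zero.2 hp0
  have hgap : fracDispersion 2 L m' = ENNReal.ofReal d := by
    rcases hm' with rfl | rfl
    · exact fracDispersion_two_eq_boostGap L p
    · rw [fracDispersion_two_eq_boostGap, boostGap_neg]
  have hocc : cellOccupation N L (planeWaveMode L m') (Φ.boost hL m').ψ = N := by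
    rw [cellOccupation_planeWaveMode_boost, hΦ, condensateOccupation_constState]
  have key := h m' hm'0 (Φ.boost hL m')
  rw [periodicGroundStateEnergy_zero_pot hL, zero_add, hgap, hocc] at key
  rw [hΦ, periodicEnergy_constState_zero_pot hL, zero_add, ← hΦ] at hE
  have key' : c * ENNReal.ofReal d * N ≤ N * ENNReal.ofReal d + ENNReal.ofReal M :=
    key.trans (add_le_add hE (ENNReal.ofReal_le_ofReal (le_max_left _ _)))
  have hfin : (N : ℝ≥0∞) * ENNReal.ofReal d + ENNReal.ofReal M ≠ ⊤ :=
    ENNReal.add_ne_top.2 ⟨ENNReal.mul_ne_top (ENNReal.natCast_ne_top N) ENNReal.ofReal_ne_top,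
      ENNReal.ofReal_ne_top⟩
  by_cases hct : c = ⊤
  · rw [hct, ENNReal.top_mul ((ENNReal.ofReal_pos.2 hdpos).ne'),
      ENNReal.top_mul (Nat.cast_ne_zero.2 hN.ne')] at key'
    exact hfin (top_le_iff.1 key')
  · have hK' : K = (c.toReal - 1) * N := by rw [hK, if_neg hct]
    have hr := ENNReal.toReal_mono hfin key'
    rw [ENNReal.toReal_mul, ENNReal.toReal_mul, ENNReal.toReal_ofReal hdpos.le,
      ENNReal.toReal_natCast, ENNReal.toReal_add (ENNReal.mul_ne_top (ENNReal.natCast_ne_top N)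
        ENNReal.ofReal_ne_top) ENNReal.ofReal_ne_top, ENNReal.toReal_mul, ENNReal.toReal_natCast,
      ENNReal.toReal_ofReal hdpos.le, ENNReal.toReal_ofReal hM0] at hr
    -- hr : c.toReal * d * N ≤ N * d + M ;  hdK : M < d * ((c.toReal - 1) * N)
    rw [hK'] at hdK
    have e1 : d * ((c.toReal - 1) * N) = c.toReal * d * N - N * d := by ring
    rw [e1] at hdK
    linarith

/-- **THE COEFFICIENT IS LOAD-BEARING EXACTLY AT `1`, already for the free gas**: with `v ≡ 0`
the crux body holds for every coefficient `c ≤ 1` (zero price) and fails for every `c > 1`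
(unbounded price). Any proof of the crux uses `2⁻¹ ≤ 1`, i.e. `T ≥ |k|²a_k†a_k` — and at `v = 0`
nothing more is available. [folklore] -/
theorem coefficient_threshold_free_gas :
    (∀ c : ℝ≥0∞, c ≤ 1 → ∀ ρ : ℝ, 0 < ρ → ∀ C : ℝ, ∀ N : ℕ, 0 < N → ModePriceBody c 0 C ρ N) ∧
    (∀ c : ℝ≥0∞, 1 < c → ∀ ρ : ℝ, 0 < ρ → ∀ C : ℝ, ∀ N : ℕ, 0 < N → ¬ ModePriceBody c 0 C ρ N) :=
  ⟨fun _ hc _ hρ C _ hN => modePriceBody_zero_pot_of_le_one hc hρ C hN,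
    fun _ hc _ hρ C _ hN => not_modePriceBody_zero_pot_of_one_lt hc hρ C hN⟩

/-- **Refuted strengthening**: the crux with ANY softening coefficient `c > 1` in place of `½` is
false (witness `v ≡ 0`, boosted constant state, `|k| → ∞`). [folklore] -/
theorem modePriceWithCoeff_false_of_one_lt {c : ℝ≥0∞} (hc : 1 < c) : ¬ ModePriceWithCoeff c := by
  intro h
  obtain ⟨C, -, ρ₀, hρ₀, h⟩ := h 0 isRepulsiveFiniteRange_zero (by simp)
  have hρ : (0 : ℝ) < ρ₀ / 2 := by positivity
  obtain ⟨N₀, hN₀⟩ := eventually_atTop.1 (h (ρ₀ / 2) hρ (by linarith))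
  exact not_modePriceBody_zero_pot_of_one_lt hc hρ C (Nat.succ_pos N₀)
    (hN₀ (N₀ + 1) (Nat.le_succ N₀))

/-- The free-gas instance of `ModePriceWithCoeff c` for `c ≤ 1` (in particular of the crux,
`c = 2⁻¹`): true with `C = 1`, `ρ₀ = 1`. [folklore] -/
theorem modePriceWithCoeff_zero_pot_of_le_one {c : ℝ≥0∞} (hc : c ≤ 1) :
    ∃ C : ℝ, 0 < C ∧ ∃ ρ₀ : ℝ, 0 < ρ₀ ∧ ∀ ρ : ℝ, 0 < ρ → ρ < ρ₀ →
      ∀ᶠ N : ℕ in atTop, ModePriceBody c 0 C ρ N :=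
  ⟨1, one_pos, 1, one_pos, fun _ hρ _ =>
    (eventually_gt_atTop 0).mono fun _ hN => modePriceBody_zero_pot_of_le_one hc hρ 1 hN⟩

/-- The crux's own conclusion at the junk model `v ≡ 0` (true for the intended reason).
[folklore] -/
theorem modePriceIntegrable_zero_pot :
    ∃ C : ℝ, 0 < C ∧ ∃ ρ₀ : ℝ, 0 < ρ₀ ∧ ∀ ρ : ℝ, 0 < ρ → ρ < ρ₀ →
      ∀ᶠ N : ℕ in atTop, ModePriceBody 2⁻¹ 0 C ρ N :=
  modePriceWithCoeff_zero_pot_of_le_one (ENNReal.inv_le_one.2 one_le_two)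

/-! ## §2 Idle hypothesis and reductions -/

/-- **`p ≠ 0` is decoration**: at `p = 0` the symbol vanishes and the body reads
`E₀ ≤ ⟨Ψ,HΨ⟩ + Cρ`, true for every `v`, `c`, `C`, `N`. [folklore] -/
theorem modePriceBody_zero_mode (c : ℝ≥0∞) (v : ℝ → ℝ≥0∞) (C ρ : ℝ) (N : ℕ)
    (Ψ : PeriodicTrialState N (sideLength ρ N)) :
    periodicGroundStateEnergy v N (sideLength ρ N) +
        c * fracDispersion 2 (sideLength ρ N) 0 *
          cellOccupation N (sideLength ρ N) (planeWaveMode (sideLength ρ N) 0) Ψ.ψ ≤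
      periodicEnergy v Ψ + ENNReal.ofReal (C * ρ) := by
  rw [fracDispersion_zero two_ne_zero, mul_zero, zero_mul, add_zero]
  exact (periodicGroundStateEnergy_le v Ψ).trans le_self_add

/-- **Only the window `⟨Ψ,HΨ⟩ < 2E₀` matters**: for any `v`, `L > 0` and any state with
`⟨Ψ,HΨ⟩ ≥ 2E₀^per` the crux body holds at every mode with ZERO budget
(`E₀ + ½|k|²n_p ≤ ½⟨Ψ,HΨ⟩ + ½⟨Ψ,HΨ⟩`). [folklore] -/
theorem modePrice_of_twice_le (hL : 0 < L) (v : ℝ → ℝ≥0∞) (Ψ : PeriodicTrialState N L)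
    (hΨ : 2 * periodicGroundStateEnergy v N L ≤ periodicEnergy v Ψ) (p : Fin 3 → ℤ) :
    periodicGroundStateEnergy v N L + 2⁻¹ * fracDispersion 2 L p *
        cellOccupation N L (planeWaveMode L p) Ψ.ψ ≤ periodicEnergy v Ψ := by
  have h1 : periodicGroundStateEnergy v N L ≤ 2⁻¹ * periodicEnergy v Ψ := by
    calc periodicGroundStateEnergy v N L = 2⁻¹ * (2 * periodicGroundStateEnergy v N L) := by
          rw [← mul_assoc, ENNReal.inv_mul_cancel (by norm_num) (by norm_num), one_mul]
      _ ≤ 2⁻¹ * periodicEnergy v Ψ := by gcongr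
  have h2 : 2⁻¹ * fracDispersion 2 L p * cellOccupation N L (planeWaveMode L p) Ψ.ψ ≤
      2⁻¹ * periodicEnergy v Ψ := by
    rw [mul_assoc]
    gcongr
    exact fracDispersion_mul_cellOccupation_le hL v Ψ p
  calc _ ≤ 2⁻¹ * periodicEnergy v Ψ + 2⁻¹ * periodicEnergy v Ψ := add_le_add h1 h2
    _ = periodicEnergy v Ψ := by rw [← add_mul, ENNReal.inv_two_add_inv_two, one_mul]

/-! ## §3 Line `Sketch` (g-notch, `t = 8πa(v)`): the open stubs F, O at the junk model `v ≡ 0` -/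

/-- At `v ≡ 0` the renormalised notch coupling `t = 8π a(v)` of stubs F/O is `0` (`a(0) = 0`), so
`F_t = E`, `M_t = 0`. (The retired bare coupling `max 0 (Re v̂(k))` is `0` there as well.) [folklore] -/
theorem gNotchCoupling_zero_pot : 8 * Real.pi * (scatteringLength (0 : ℝ → ℝ≥0∞)).toReal = 0 := by
  rw [scatteringLength_zero, ENNReal.toReal_zero, mul_zero]

/-- The retired bare notch coupling also vanishes at `v ≡ 0`. [folklore] -/
theorem notchCoupling_zero_pot (L : ℝ) (m : Fin 3 → ℤ) :
    max 0 (∫ x : EuclideanSpace ℝ (Fin 3), ((0 : ℝ → ℝ≥0∞) ‖x‖).toReal *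
      Real.cos (2 * Real.pi / L * ∑ r : Fin 3, (m r : ℝ) * x r)) = 0 := by
  simp

/-- With `t = 0` the notch functional's added term vanishes identically (`ofReal (2·0/L³) = 0`),
whatever the (possibly infinite) integral it multiplies: `F_0 = E`, `M_0 = 0`. [folklore] -/
theorem notchTerm_zero (L : ℝ) (I : ℝ≥0∞) :
    ENNReal.ofReal (2 * 0 / L ^ 3) * I = 0 ∧ ENNReal.ofReal (0 / L ^ 3) * I = 0 := by
  simp

/-- **Stub O (`stub_softenedGNotchedOccupation`) at `v ≡ 0` holds with `Φ = constState`**: for every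
`s ≤ |2πm/L|²` (the stub has `s = ½|2πm/L|²`), every `δ` and every `Ψ`,
`F(const) + s n_m(Ψ) ≤ F(Ψ) + s n_m(const) + δ` (with `F = E` at `t = 0`), and
`s n_m(const) = 0 ≤ C₂ρ`. Likewise stub F (`stub_gNotchedStructureFactor`) at `v ≡ 0` holds with
`Φ = constState` (`constState_free_nearMin`, `M_0 = 0`). The open stubs are not refutable at the
junk model. [folklore] -/
theorem stubO_zero_pot_witness (hL : 0 < L) {m : Fin 3 → ℤ} (hm : m ≠ 0) {s : ℝ≥0∞}
    (hs : s ≤ fracDispersion 2 L m) (δ : ℝ≥0∞) (Ψ : PeriodicTrialState N L) :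
    periodicEnergy (0 : ℝ → ℝ≥0∞) (constState N hL) +
          s * cellOccupation N L (planeWaveMode L m) Ψ.ψ ≤
        periodicEnergy (0 : ℝ → ℝ≥0∞) Ψ +
          s * cellOccupation N L (planeWaveMode L m) (constState N hL).ψ + δ ∧
      s * cellOccupation N L (planeWaveMode L m) (constState N hL).ψ = 0 := by
  rw [periodicEnergy_constState_zero_pot, zero_add, cellOccupation_constState_eq_zero hL hm,
    mul_zero, add_zero]
  exact ⟨((mul_le_mul_of_nonneg_right hs bot_le).trans
    (fracDispersion_mul_cellOccupation_le hL 0 Ψ m)).trans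
    le_self_add, rfl⟩

end Summit.AtomisticToContinuum.BoseEinsteinCondensation.Cruxes.ModePriceIntegrable.Disproof

end
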